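import Summits.SmoothPoincare4.SmoothPoincare4.Theses.ZeroSurgeryExotic
import Summits.SmoothPoincare4.SmoothPoincare4.Theorems.ZeroSurgeryExoticAssembly
import Summits.SmoothPoincare4.SmoothPoincare4.Theorems.ZseSVanishesOnPairs.Negative.Position
import Literature.Topology.FourManifolds.HomotopyBallSliceSphereProofs
import Literature.Topology.FourManifolds.SPC4Wave0Proofs

/-!
# The FGMW waypoint `ZseHsliceNotSlice`: its exact logical position (support lemmas for item stmt-SmoothPoincare4-0520)

Route `SmoothPoincare4/ZeroSurgeryExotic`, support item stmt-SmoothPoincare4-0520, decl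
`Summit.SmoothPoincare4.SmoothPoincare4.Theses.ZeroSurgeryExotic.ZseHsliceNotSlice`:

> `∃ K : Knot, K.IsHomotopyBallSlice ∧ ¬ K.IsSmoothlySlice` — some knot is slice in a homotopy 4-ball but
> not in `B⁴` (Freedman–Gompf–Morrison–Walker 2010, §1; Manolescu–Piccirillo 2023, §1).

The statement is OPEN as filed (it is the common waypoint of every "H-slice in a homotopy ball" strategy
against SPC4). This file records, as theorems over the tree's discharged lemmas, exactly where it sits:

* **below it** (each implies the waypoint): the route target `ZseThesis` (a `0`-surgery pair with `K` slice,
  `K'` not) — `of_zseThesis`, through the PROVED Manolescu–Piccirillo Lemma 3.3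
  (`Literature.Uncategorized.isHomotopyBallSlice_of_zeroSurgeryPair`); crux 2 `Literature.Uncategorized.Crux`
  (an `s`-witness pair) and the registered open statement `FGMWRasmussenStrategy` (an H-slice knot with
  `s ≠ 0`), each GIVEN Rasmussen's Theorem 1 (`eq_zero_of_isSmoothlySlice`, named fact) — `of_crux`,
  `of_fgmwRasmussenStrategy`;
* **above it**: the waypoint refutes `SmoothPoincare4` outright — `not_smoothPoincare4`, `exists_exotic`
  (and `existsExoticFourSphere`, the homeomorphism form, GIVEN Freedman's theorem `nonempty_homeomorph_sphere_four`)
  (the FGMW lemma is PROVED in the tree, `Knot.exists_exotic_of_isHomotopyBallSlice_not_isSmoothlySlice_holds`,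
  via Palais' disc theorem); equivalently SPC4 refutes the waypoint — `not_of_smoothPoincare4`; and a refutation
  of the waypoint answers MMSW Question 9.11 (knots) positively, given Rasmussen's Theorem 1 —
  `mmsw2023Question911Knot_of_not`;
* **sharpenings** (Palais' theorem again): smooth sliceness in `B⁴` is literally H-sliceness in the STANDARD
  `S⁴` — `isSmoothlySlice_iff_exists_isSliceDiscIn_sphere`; hence a disc in any punctured homotopy sphere
  diffeomorphic to `S⁴` is already a slice disc — `isSmoothlySlice_of_isSliceDiscIn_of_diffeomorph`; so the
  waypoint says precisely that H-sliceness depends on the homotopy 4-sphere —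
  `iff_exists_isHomotopyBallSlice_not_isSliceDiscIn_sphere` — and EVERY witness `(K, Σ)` has `Σ` exotic —
  `iff_exists_exotic_witness`; and in Manolescu–Piccirillo's checkable form (closed simply connected `M` with
  `H₂ = 0`, by the tree's proved recognition theorem `nonempty_homotopyEquiv_sphere_four_iff_holds`) —
  `iff_exists_simplyConnected_witness`.

No definitions, no named facts, no `sorry`; nothing here concludes the item (it is `--supports` material).

## References

* M. Freedman, R. Gompf, S. Morrison, K. Walker, *Man and machine thinking about the smooth 4-dimensional
  Poincaré conjecture*, Quantum Topol. 1 (2010), §1 and Fact 2.1 [FreedmanGompfMorrisonWalker2010].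
* C. Manolescu, L. Piccirillo, *From zero surgeries to candidates for exotic definite 4-manifolds*,
  J. Lond. Math. Soc. 108 (2023), §1 and Lemma 3.3 [ManolescuPiccirillo2023].
* C. Manolescu, M. Marengon, S. Sarkar, M. Willis, *A generalization of Rasmussen's invariant*, Duke Math. J.
  172 (2023), Question 9.11 [ManolescuMarengonSarkarWillis2023].
* J. Rasmussen, *Khovanov homology and the slice genus*, Invent. Math. 182 (2010), Thm. 1 [Rasmussen2010].
* R. Palais, *Extending diffeomorphisms*, Proc. AMS 11 (1960), Thm. B [Palais1960].
-/

noncomputable section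

open scoped Manifold ContDiff
open ContinuousMap
open Literature.Topology.FourManifolds Literature.Uncategorized Literature.Barriers.SmoothPoincare4

namespace Summit.SmoothPoincare4.SmoothPoincare4.Theorems.ZseHsliceNotSlice

open Summit.SmoothPoincare4.SmoothPoincare4.Theses.ZeroSurgeryExotic

/-! ### Unfolding -/

/-- The waypoint unfolded: it is the bare existential `∃ K, K.IsHomotopyBallSlice ∧ ¬ K.IsSmoothlySlice`.
[folklore] -/
theorem iff : ZseHsliceNotSlice ↔ ∃ K : Knot, K.IsHomotopyBallSlice ∧ ¬ K.IsSmoothlySlice := Iff.rfl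

/-- The waypoint is the failure of "slice in a homotopy 4-ball ⇒ slice in `B⁴`". [folklore] -/
theorem iff_not_forall : ZseHsliceNotSlice ↔ ¬ ∀ K : Knot, K.IsHomotopyBallSlice → K.IsSmoothlySlice := by
  simp only [iff, not_forall, exists_prop]

/-! ### Below the waypoint -/

/-- **The route target implies the waypoint** (Manolescu–Piccirillo, §1 p. 1, first sentence): from a
`0`-surgery pair `(K, K')` with `K` smoothly slice and `K'` not, `K'` is slice in a homotopy 4-ball by the
PROVED Lemma 3.3 (`W = S⁴`) and is the required knot. [cite: ManolescuPiccirillo2023, §1 p. 1 and Lemma 3.3] -/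
theorem of_zseThesis (h : ZseThesis) : ZseHsliceNotSlice := by
  obtain ⟨K, K', Y, _, _, hK, hK', hsl, hns⟩ := h
  exact ⟨K', isHomotopyBallSlice_of_zeroSurgeryPair hK hK' hsl, hns⟩

/-- **Crux 2 implies the waypoint, given Rasmussen's Theorem 1**: an `s`-witness pair (`K` slice,
`s(K') ≠ 0`, common `0`-surgery) gives the H-slice knot `K'`, not slice since slice knots have `s = 0`.
[cite: ManolescuPiccirillo2023, §1 p. 1] -/
theorem of_crux (hR : eq_zero_of_isSmoothlySlice) (h : Crux) : ZseHsliceNotSlice := by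
  obtain ⟨K, K', Y, _, _, s, hK, hK', hsl, hs, hs0⟩ := h
  exact ⟨K', isHomotopyBallSlice_of_zeroSurgeryPair hK hK' hsl, fun hsl' ↦ hs0 (hR hs hsl')⟩

/-- **The FGMW `s`-strategy implies the waypoint, given Rasmussen's Theorem 1**: a knot slice in a
homotopy ball with `s ≠ 0` is not slice in `B⁴`. [cite: FreedmanGompfMorrisonWalker2010, §1] -/
theorem of_fgmwRasmussenStrategy (hR : eq_zero_of_isSmoothlySlice) (h : FGMWRasmussenStrategy) :
    ZseHsliceNotSlice := by
  obtain ⟨K, hK, s, hs, hs0⟩ := h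
  exact ⟨K, hK, fun hsl ↦ hs0 (hR hs hsl)⟩

/-! ### Above the waypoint -/

/-- **The waypoint refutes SPC4**, unconditionally: the FGMW lemma is a theorem of the tree
(`Knot.exists_exotic_of_isHomotopyBallSlice_not_isSmoothlySlice_holds`) and the assembly
`not_smoothPoincare4_of_isHomotopyBallSlice_not_isSmoothlySlice` (item 0521) is pure logic.
[cite: FreedmanGompfMorrisonWalker2010, Fact 2.1] -/
theorem not_smoothPoincare4 (h : ZseHsliceNotSlice) : ¬ _root_.SmoothPoincare4 :=
  Summit.SmoothPoincare4.ZeroSurgeryExotic.not_smoothPoincare4_of_isHomotopyBallSlice_not_isSmoothlySlice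
    Knot.exists_exotic_of_isHomotopyBallSlice_not_isSmoothlySlice_holds h

/-- **The waypoint yields an exotic 4-sphere**: a closed smooth 4-manifold homotopy equivalent but not
diffeomorphic to `S⁴` (the FGMW lemma, proved in the tree). [cite: FreedmanGompfMorrisonWalker2010, Fact 2.1] -/
theorem exists_exotic (h : ZseHsliceNotSlice) :
    ∃ (M : Type) (_ : TopologicalSpace M) (_ : T2Space M) (_ : SecondCountableTopology M)
      (_ : ChartedSpace (EuclideanSpace ℝ (Fin 4)) M) (_ : IsManifold (𝓡 4) ∞ M) (_ : CompactSpace M),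
      Nonempty (M ≃ₕ (Metric.sphere (0 : EuclideanSpace ℝ (Fin 5)) 1)) ∧
        IsEmpty (M ≃ₘ⟮𝓡 4, 𝓡 4⟯ (Metric.sphere (0 : EuclideanSpace ℝ (Fin 5)) 1)) :=
  Knot.exists_exotic_of_isHomotopyBallSlice_not_isSmoothlySlice_holds h

/-- **The waypoint gives an exotic 4-sphere in the homeomorphism sense, given Freedman's theorem**
(`nonempty_homeomorph_sphere_four`, named fact: a homotopy 4-sphere is homeomorphic to `S⁴`): the registered
open statement `ExistsExoticFourSphere` (some smooth 4-manifold homeomorphic but not diffeomorphic to `S⁴`).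
[cite: FreedmanGompfMorrisonWalker2010, §1 Conjecture 1 and Fact 2.1] -/
theorem existsExoticFourSphere (hF : nonempty_homeomorph_sphere_four.{0}) (h : ZseHsliceNotSlice) :
    ExistsExoticFourSphere := by
  obtain ⟨M, _, _, _, _, _, _, ⟨e⟩, hE⟩ := exists_exotic h
  obtain ⟨φ⟩ := hF M e
  exact ⟨M, _, _, ‹_›, φ, hE⟩

/-- **SPC4 refutes the waypoint** (negative side of the item: under SPC4 every homotopy-ball-slice knot
is slice, `isSmoothlySlice_of_isHomotopyBallSlice_of_spc4`). Hence a refutation of the item is at most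
SPC4-hard and a proof of it is a disproof of SPC4. [cite: FreedmanGompfMorrisonWalker2010, §1] -/
theorem not_of_smoothPoincare4 (hS : _root_.SmoothPoincare4) : ¬ ZseHsliceNotSlice := by
  rintro ⟨K, hK, hns⟩
  exact hns (ZseSVanishesOnPairs.Negative.isSmoothlySlice_of_isHomotopyBallSlice_of_spc4 hS hK)

/-- **Refuting the waypoint answers MMSW Question 9.11 (knots) positively, given Rasmussen's Theorem 1**:
if every homotopy-ball-slice knot is slice, each has `s = 0` (contrapositive of `of_fgmwRasmussenStrategy` through
`not_fgmwRasmussenStrategy_iff_question`). So `¬` the item is at least as strong as the open Question 9.11.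
[cite: ManolescuMarengonSarkarWillis2023, Question 9.11] -/
theorem mmsw2023Question911Knot_of_not (hR : eq_zero_of_isSmoothlySlice) (h : ¬ ZseHsliceNotSlice) :
    MMSW2023Question911Knot :=
  not_fgmwRasmussenStrategy_iff_question.1 fun hF ↦ h (of_fgmwRasmussenStrategy hR hF)

/-! ### Sharpenings through Palais' disc theorem -/

/-- **Smooth sliceness is H-sliceness in the standard sphere.** `K` is smoothly slice in `B⁴` iff it
bounds a smooth proper disc in `S⁴ ∖ e(B̊⁴)` for some smooth ball `e : ℝ⁴ ↪ S⁴`: push a slice disc through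
the inversion into the complement of a round ball (`Knot.IsSliceDisc.isSliceDiscIn_sphere`); conversely the
complement of any smooth open ball in `S⁴` is a smooth closed ball with the same boundary parametrisation
(Palais, `Knot.palais_ballComplement_sphere_four_holds`), along which the disc pulls back to a proper disc
in `B⁴` (`Knot.IsSliceDiscIn.exists_isProperDisc`), which neatens (`Knot.isSmoothlySlice_of_isProperDisc_holds`).
[cite: Palais1960, Thm. B] -/
theorem isSmoothlySlice_iff_exists_isSliceDiscIn_sphere (K : Knot) :
    K.IsSmoothlySlice ↔
      ∃ (e : EuclideanSpace ℝ (Fin 4) → (Metric.sphere (0 : EuclideanSpace ℝ (Fin 5)) 1))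
        (f : EuclideanSpace ℝ (Fin 2) → (Metric.sphere (0 : EuclideanSpace ℝ (Fin 5)) 1)),
        K.IsSliceDiscIn (Metric.sphere (0 : EuclideanSpace ℝ (Fin 5)) 1) e f := by
  constructor
  · rintro ⟨g, hg⟩
    exact ⟨_, _, hg.isSliceDiscIn_sphere ⟨EuclideanSpace.single 0 1, by simp⟩⟩
  · rintro ⟨e, f, h⟩
    obtain ⟨U, c, hc₁, hc₂⟩ := Knot.palais_ballComplement_sphere_four_holds e h.isSmoothEmbedding
    obtain ⟨g, hg⟩ := h.exists_isProperDisc c hc₁ hc₂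
    exact Knot.isSmoothlySlice_of_isProperDisc_holds K g hg

/-- **A disc in a punctured homotopy sphere diffeomorphic to `S⁴` is a slice disc**: transport by the
diffeomorphism (`Knot.IsSliceDiscIn.diffeomorph_comp`) and apply the previous lemma. This is the
contrapositive core of the FGMW lemma. [cite: FreedmanGompfMorrisonWalker2010, §2 p. 6] -/
theorem isSmoothlySlice_of_isSliceDiscIn_of_diffeomorph {M : Type} [TopologicalSpace M]
    [ChartedSpace (EuclideanSpace ℝ (Fin 4)) M] [IsManifold (𝓡 4) ∞ M] {K : Knot}
    {e : EuclideanSpace ℝ (Fin 4) → M} {f : EuclideanSpace ℝ (Fin 2) → M} (h : K.IsSliceDiscIn M e f)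
    (φ : M ≃ₘ⟮𝓡 4, 𝓡 4⟯ (Metric.sphere (0 : EuclideanSpace ℝ (Fin 5)) 1)) : K.IsSmoothlySlice :=
  (isSmoothlySlice_iff_exists_isSliceDiscIn_sphere K).2 ⟨_, _, h.diffeomorph_comp φ⟩

/-- **The waypoint says that H-sliceness depends on the homotopy 4-sphere**: some knot bounds a proper
disc in a punctured homotopy 4-sphere but none in the punctured standard `S⁴`.
[cite: FreedmanGompfMorrisonWalker2010, §1] -/
theorem iff_exists_isHomotopyBallSlice_not_isSliceDiscIn_sphere :
    ZseHsliceNotSlice ↔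
      ∃ K : Knot, K.IsHomotopyBallSlice ∧
        ¬ ∃ (e : EuclideanSpace ℝ (Fin 4) → (Metric.sphere (0 : EuclideanSpace ℝ (Fin 5)) 1))
            (f : EuclideanSpace ℝ (Fin 2) → (Metric.sphere (0 : EuclideanSpace ℝ (Fin 5)) 1)),
            K.IsSliceDiscIn (Metric.sphere (0 : EuclideanSpace ℝ (Fin 5)) 1) e f := by
  simp only [iff, isSmoothlySlice_iff_exists_isSliceDiscIn_sphere]

/-- **Every witness lives in an exotic sphere.** The waypoint holds iff some knot `K`, not slice in `B⁴`,
bounds a proper disc in `Σ ∖ e(B̊⁴)` for a closed smooth `Σ` homotopy equivalent and NOT diffeomorphic to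
`S⁴` — the homotopy sphere of any witness is itself exotic (were `Σ ≃ S⁴`, the disc would be a slice disc,
`isSmoothlySlice_of_isSliceDiscIn_of_diffeomorph`). [cite: FreedmanGompfMorrisonWalker2010, Fact 2.1] -/
theorem iff_exists_exotic_witness :
    ZseHsliceNotSlice ↔
      ∃ (K : Knot) (M : Type) (_ : TopologicalSpace M) (_ : T2Space M) (_ : SecondCountableTopology M)
        (_ : ChartedSpace (EuclideanSpace ℝ (Fin 4)) M) (_ : IsManifold (𝓡 4) ∞ M) (_ : CompactSpace M)
        (e : EuclideanSpace ℝ (Fin 4) → M) (f : EuclideanSpace ℝ (Fin 2) → M),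
        Nonempty (M ≃ₕ (Metric.sphere (0 : EuclideanSpace ℝ (Fin 5)) 1)) ∧
          IsEmpty (M ≃ₘ⟮𝓡 4, 𝓡 4⟯ (Metric.sphere (0 : EuclideanSpace ℝ (Fin 5)) 1)) ∧
          K.IsSliceDiscIn M e f ∧ ¬ K.IsSmoothlySlice := by
  constructor
  · rintro ⟨K, ⟨M, _, _, _, _, _, _, hM, e, f, hef⟩, hns⟩
    refine ⟨K, M, _, ‹_›, ‹_›, _, ‹_›, ‹_›, e, f, hM, ⟨fun φ ↦ ?_⟩, hef, hns⟩
    exact hns (isSmoothlySlice_of_isSliceDiscIn_of_diffeomorph hef φ)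
  · rintro ⟨K, M, _, _, _, _, _, _, e, f, hM, -, hef, hns⟩
    exact ⟨K, hef.isHomotopyBallSlice hM, hns⟩

/-- **The waypoint in Manolescu–Piccirillo's checkable form**: some knot `K`, not slice in `B⁴`, bounds a
proper disc off a ball in a closed smooth SIMPLY CONNECTED 4-manifold with `H₂(M; ℤ) = 0` — the recognition of
homotopy 4-spheres by `π₁ = 1`, `H₂ = 0` (Hurewicz + Whitehead + Poincaré duality) being a theorem of the tree
(`nonempty_homotopyEquiv_sphere_four_iff_holds`). This is the shape in which the `0`-surgery construction
(`X(K') ∪_Y V`, MP Lemma 3.3) delivers its homotopy sphere.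
[cite: ManolescuPiccirillo2023, §3.2, proof of Lemma 3.3] -/
theorem iff_exists_simplyConnected_witness :
    ZseHsliceNotSlice ↔
      ∃ (K : Knot) (M : Type) (_ : TopologicalSpace M) (_ : T2Space M) (_ : SecondCountableTopology M)
        (_ : ChartedSpace (EuclideanSpace ℝ (Fin 4)) M) (_ : IsManifold (𝓡 4) ∞ M) (_ : CompactSpace M)
        (e : EuclideanSpace ℝ (Fin 4) → M) (f : EuclideanSpace ℝ (Fin 2) → M),
        SimplyConnectedSpace M ∧ CategoryTheory.Limits.IsZero (singularHomologyZ M 2) ∧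
          K.IsSliceDiscIn M e f ∧ ¬ K.IsSmoothlySlice := by
  constructor
  · rintro ⟨K, ⟨M, _, _, _, _, _, _, hM, e, f, hef⟩, hns⟩
    obtain ⟨h1, h2⟩ := (nonempty_homotopyEquiv_sphere_four_iff_holds M).1 hM
    exact ⟨K, M, _, ‹_›, ‹_›, _, ‹_›, ‹_›, e, f, h1, h2, hef, hns⟩
  · rintro ⟨K, M, _, _, _, _, _, _, e, f, h1, h2, hef, hns⟩
    exact ⟨K, hef.isHomotopyBallSlice ((nonempty_homotopyEquiv_sphere_four_iff_holds M).2 ⟨h1, h2⟩), hns⟩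

end Summit.SmoothPoincare4.SmoothPoincare4.Theorems.ZseHsliceNotSlice

end
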